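import Literature.NumberTheory.ConnesMoscovici2022.UVProlateSoninProofs
import Mathlib.Analysis.SpecialFunctions.Integrability.Basic
import HarnessLib

/-!
# Connes–Moscovici 2022, Corollary 1.7 (i): eigenfunctions of `W_sa` near the singular point `λ`

Topic `Literature/NumberTheory/ConnesMoscovici2022`; companion of `UVProlateSpectrum.lean` (the named
fact `CM22_cor_1_7`, [ConnesMoscovici2022, Cor 1.7] = arXiv:2112.05500 Cor 2.7: "If `φ` is an
eigenfunction of `W_sa^±` then (i) `φ` is regular on `[λ, λ+ε)` and on `(λ−ε, λ]` for some `ε > 0`,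
with a possible discontinuity at `λ`; (ii) the leading term of the asymptotic expansion of `φ` at `∞` is
proportional to `sin(2πλx)/x` (even) / `cos(2πλx)/x` (odd)") and of seat cc-t9's
`UVProlateSoninProofs.lean` (interior regularity of the boundary-condition representative).
THIS FILE PROVES CLAUSE (i) AS TYPED (`CM22_cor_1_7_clause_i`, theorems only, no named fact);
clause (ii) (asymptotics at the irregular singular point `∞`) is NOT addressed.

## Contents

* `exists_tendsto_nhdsGT_of_singular_endpoint` / `exists_tendsto_nhdsLT_of_singular_endpoint` —
  abstract one-sided limit lemmas at a regular singular endpoint: if `g ∈ C¹(a,b) ∩ L²(a,b)`,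
  `u = p g′` satisfies `u′ = r g` with `r` continuous and bounded, `‖p(x)‖ ≥ m·dist(x, endpoint)` and
  `u → 0` at the endpoint (the boundary condition (1.19) `lim (λ² − x²)∂ξ = 0`), then `g` has a
  limit there.  Mechanism: `u(x) = ∫_a^x r g = O(√(x−a))` by the pointwise AM–GM bound
  `|g| ≤ (δ + |g|²/δ)/2` with `δ = (x−a)^{-1/2}` (no Hölder), hence `g′ = u/p = O((x−a)^{-1/2})` is
  integrable and `g = g(x₁) + ∫ g′` extends continuously.
* `hasDerivAt_pCoeff_mul_deriv_repr` — for the representative `g` of `ξ ∈ dom W_max` with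
  `W_max ξ = μ ξ`: `(p g′)′ = (q − μ) g` off `±λ` (classical equation via `prolateWaveOpFun_repr_eq`).
* `CM22_cor_1_7_i` — for `W` with `IsProlateSA λ W` and an eigenvector `φ` (`μ ∈ ℝ`): the
  boundary-condition representative `g` (`φ = g` a.e., `ProlateBC λ g`) is `C^∞` off `±λ`, in
  particular on `(λ, 2λ)` and `(0, λ)`, and has one-sided limits at `λ⁺` and `λ⁻`;
  `CM22_cor_1_7_clause_i` restates clause (i) in the fact's exact binder shape.

RH-context: RH-FREE corpus literature (spectral theory of the prolate wave operator, CM22 §1 sequel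
row); bears on no statement about `ζ`; nothing here bears on the truth of RH.
-/

noncomputable section

open Complex Set MeasureTheory Filter Topology intervalIntegral
open scoped Real Topology ContDiff

namespace Literature.NumberTheory.ConnesMoscovici2022

/-! ## One-sided limits at a regular singular endpoint (abstract real analysis) -/

section Endpoint

/-- AM–GM in the form `t ≤ (δ + t²/δ)/2` (`δ > 0`). [folklore] -/
private theorem le_half_add_sq_div (t : ℝ) {δ : ℝ} (hδ : 0 < δ) : t ≤ (δ + t ^ 2 / δ) / 2 := by
  have h : (δ + t ^ 2 / δ) / 2 = (δ ^ 2 + t ^ 2) / (2 * δ) := by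
    field_simp
  rw [h, le_div_iff₀ (by positivity)]
  nlinarith [sq_nonneg (δ - t)]

/-- `∫_a^x ‖g‖ ≤ (1 + ‖g‖²_{L²(a,b)})/2 · √(x − a)` for `g ∈ L²(a,b)` continuous on `(a,b)` (AM–GM with
`δ = (x−a)^{-1/2}`; no Hölder needed). [folklore] -/
private theorem integral_norm_le_sqrt {a b : ℝ} {g : ℝ → ℂ} (hgc : ContinuousOn g (Ioo a b))
    (hL2 : IntegrableOn (fun x => ‖g x‖ ^ 2) (Ioo a b)) {x : ℝ} (hx : x ∈ Ioo a b) :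
    ∫ t in a..x, ‖g t‖ ≤ (1 + ∫ t in Ioo a b, ‖g t‖ ^ 2) / 2 * Real.sqrt (x - a) := by
  have hax : a < x := hx.1
  have hxa : 0 < x - a := sub_pos.2 hax
  set N : ℝ := ∫ t in Ioo a b, ‖g t‖ ^ 2 with hN
  have hN0 : 0 ≤ N := setIntegral_nonneg measurableSet_Ioo fun t _ => by positivity
  set δ : ℝ := (Real.sqrt (x - a))⁻¹ with hδ
  have hsqrt : 0 < Real.sqrt (x - a) := Real.sqrt_pos.2 hxa
  have hδ0 : 0 < δ := inv_pos.2 hsqrt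
  have hsub : Ioo a x ⊆ Ioo a b := Ioo_subset_Ioo_right hx.2.le
  -- integrability on [a, x]
  have hL2x : IntervalIntegrable (fun t => ‖g t‖ ^ 2) volume a x := by
    rw [intervalIntegrable_iff_integrableOn_Ioo_of_le hax.le]
    exact hL2.mono_set hsub
  have hgn : IntervalIntegrable (fun t => ‖g t‖) volume a x := by
    rw [intervalIntegrable_iff_integrableOn_Ioo_of_le hax.le]
    have hmeas : AEStronglyMeasurable (fun t => ‖g t‖) (volume.restrict (Ioo a x)) :=
      (hgc.mono hsub).norm.aestronglyMeasurable measurableSet_Ioo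
    have hc : IntegrableOn (fun _ : ℝ => (1:ℝ)/2) (Ioo a x) volume :=
      integrableOn_const (measure_Ioo_lt_top (a := a) (b := x)).ne
    refine Integrable.mono' (((hL2.mono_set hsub).div_const 1).add hc)
      hmeas (ae_of_all _ fun t => ?_)
    rw [Real.norm_eq_abs, abs_norm]
    simp only [Pi.add_apply, div_one]
    nlinarith [sq_nonneg (‖g t‖ - 1)]
  calc ∫ t in a..x, ‖g t‖ ≤ ∫ t in a..x, (δ + ‖g t‖ ^ 2 / δ) / 2 := by
        refine intervalIntegral.integral_mono_on hax.le hgn ?_ fun t _ => le_half_add_sq_div _ hδ0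
        exact (intervalIntegrable_const.add (hL2x.div_const δ)).div_const 2
    _ = (δ * (x - a) + (∫ t in a..x, ‖g t‖ ^ 2) / δ) / 2 := by
        rw [intervalIntegral.integral_div, intervalIntegral.integral_add intervalIntegrable_const
          (hL2x.div_const δ), intervalIntegral.integral_const, intervalIntegral.integral_div, smul_eq_mul]
        ring
    _ ≤ (δ * (x - a) + N / δ) / 2 := by
        gcongr
        rw [intervalIntegral.integral_of_le hax.le, hN]
        calc ∫ t in Ioc a x, ‖g t‖ ^ 2 = ∫ t in Ioo a x, ‖g t‖ ^ 2 := setIntegral_congr_set Ioo_ae_eq_Ioc.symm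
          _ ≤ ∫ t in Ioo a b, ‖g t‖ ^ 2 :=
            setIntegral_mono_set hL2 (ae_of_all _ fun t => by positivity) (ae_of_all _ hsub)
    _ = (1 + N) / 2 * Real.sqrt (x - a) := by
        have h1 : δ * (x - a) = Real.sqrt (x - a) := by
          rw [hδ, inv_mul_eq_div, div_eq_iff hsqrt.ne', Real.mul_self_sqrt hxa.le]
        have h2 : N / δ = N * Real.sqrt (x - a) := by rw [hδ, div_inv_eq_mul]
        rw [h1, h2]; ring

/-- **One-sided limit at a regular singular endpoint (right of `a`).**  Let `g` be `C¹` on `(a,b)` and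
square integrable there, `u = p g′` with `u′ = r g` (`r` continuous and bounded by `Q`),
`‖p(x)‖ ≥ m (x − a)` (`m > 0`) and `u(x) → 0` as `x → a⁺` (the boundary condition
`lim (λ² − x²) ∂ξ = 0` of [ConnesMoscovici2022, (1.19)]).  Then `g` has a limit at `a⁺`:
`u(x) = ∫_a^x r g = O(√(x−a))` so `g′ = O((x−a)^{-1/2})` is integrable.
[cite: ConnesMoscovici2022, Cor 1.7 (i) (= arXiv:2112.05500 Cor 2.7, chunk p0006:L116–L123)] -/
theorem exists_tendsto_nhdsGT_of_singular_endpoint {a b m Q : ℝ} (hab : a < b) (hm : 0 < m)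
    {g p r : ℝ → ℂ} (hg : ContDiffOn ℝ 1 g (Ioo a b))
    (hu : ∀ x ∈ Ioo a b, HasDerivAt (fun y => p y * deriv g y) (r x * g x) x)
    (hrc : ContinuousOn r (Ioo a b)) (hr : ∀ x ∈ Ioo a b, ‖r x‖ ≤ Q)
    (hp : ∀ x ∈ Ioo a b, m * (x - a) ≤ ‖p x‖)
    (hbc : Tendsto (fun x => p x * deriv g x) (𝓝[>] a) (𝓝 0))
    (hL2 : IntegrableOn (fun x => ‖g x‖ ^ 2) (Ioo a b)) :
    ∃ c : ℂ, Tendsto g (𝓝[>] a) (𝓝 c) := by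
  set u : ℝ → ℂ := fun y => p y * deriv g y with hu_def
  set N : ℝ := ∫ t in Ioo a b, ‖g t‖ ^ 2 with hN
  have hN0 : 0 ≤ N := setIntegral_nonneg measurableSet_Ioo fun t _ => by positivity
  have hQ0 : 0 ≤ Q := (norm_nonneg _).trans (hr _ ⟨(left_lt_add_div_two.2 hab), add_div_two_lt_right.2 hab⟩)
  have hgc : ContinuousOn g (Ioo a b) := hg.continuousOn
  have hgd : ∀ x ∈ Ioo a b, HasDerivAt g (deriv g x) x := fun x hx =>
    ((hg.differentiableOn one_ne_zero x hx).differentiableAt (Ioo_mem_nhds hx.1 hx.2)).hasDerivAt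
  have hg'c : ContinuousOn (deriv g) (Ioo a b) := hg.continuousOn_deriv_of_isOpen isOpen_Ioo le_rfl
  -- Step 1: ‖u x‖ ≤ Q ∫_a^x ‖g‖
  have hgn_int : ∀ x ∈ Ioo a b, IntervalIntegrable (fun t => ‖g t‖) volume a x := by
    intro x hx
    rw [intervalIntegrable_iff_integrableOn_Ioo_of_le hx.1.le]
    have hsub : Ioo a x ⊆ Ioo a b := Ioo_subset_Ioo_right hx.2.le
    have hmeas : AEStronglyMeasurable (fun t => ‖g t‖) (volume.restrict (Ioo a x)) :=
      (hgc.mono hsub).norm.aestronglyMeasurable measurableSet_Ioo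
    have hc : IntegrableOn (fun _ : ℝ => (1:ℝ)/2) (Ioo a x) volume :=
      integrableOn_const (measure_Ioo_lt_top (a := a) (b := x)).ne
    refine Integrable.mono' (((hL2.mono_set hsub).div_const 1).add hc)
      hmeas (ae_of_all _ fun t => ?_)
    rw [Real.norm_eq_abs, abs_norm]
    simp only [Pi.add_apply, div_one]
    nlinarith [sq_nonneg (‖g t‖ - 1)]
  have hu_bound : ∀ x ∈ Ioo a b, ‖u x‖ ≤ Q * ∫ t in a..x, ‖g t‖ := by
    intro x hx
    have hK : ∀ y ∈ Ioo a x, ‖u x‖ ≤ ‖u y‖ + Q * ∫ t in a..x, ‖g t‖ := by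
      intro y hy
      have hyb : y < b := hy.2.trans hx.2
      have hsub : uIcc y x ⊆ Ioo a b := by
        rw [uIcc_of_le hy.2.le]; exact fun t ht => ⟨hy.1.trans_le ht.1, ht.2.trans_lt hx.2⟩
      have hFTC : ∫ t in y..x, r t * g t = u x - u y :=
        integral_eq_sub_of_hasDerivAt (fun t ht => hu t (hsub ht))
          (((hrc.mul hgc).mono hsub).intervalIntegrable)
      have h1 : ‖u x - u y‖ ≤ Q * ∫ t in y..x, ‖g t‖ := by
        rw [← hFTC]
        calc ‖∫ t in y..x, r t * g t‖ ≤ ∫ t in y..x, Q * ‖g t‖ := by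
              refine intervalIntegral.norm_integral_le_of_norm_le hy.2.le
                (ae_of_all _ fun t ht => ?_) (((hgn_int x hx).mono_set ?_).const_mul Q)
              · rw [norm_mul]
                exact mul_le_mul_of_nonneg_right (hr t ⟨hy.1.trans ht.1, ht.2.trans_lt hx.2⟩)
                  (norm_nonneg _)
              · rw [uIcc_of_le hy.2.le, uIcc_of_le hx.1.le]; exact Icc_subset_Icc hy.1.le le_rfl
          _ = Q * ∫ t in y..x, ‖g t‖ := intervalIntegral.integral_const_mul _ _
      have h2 : ∫ t in y..x, ‖g t‖ ≤ ∫ t in a..x, ‖g t‖ := by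
        have hi1 : IntervalIntegrable (fun t => ‖g t‖) volume a y :=
          (hgn_int x hx).mono_set (by
            rw [uIcc_of_le hy.1.le, uIcc_of_le hx.1.le]; exact Icc_subset_Icc le_rfl hy.2.le)
        have hi2 : IntervalIntegrable (fun t => ‖g t‖) volume y x :=
          (hgn_int x hx).mono_set (by
            rw [uIcc_of_le hy.2.le, uIcc_of_le hx.1.le]; exact Icc_subset_Icc hy.1.le le_rfl)
        have hadd := intervalIntegral.integral_add_adjacent_intervals hi1 hi2
        have h0 : 0 ≤ ∫ t in a..y, ‖g t‖ :=
          intervalIntegral.integral_nonneg hy.1.le fun t _ => norm_nonneg _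
        linarith
      calc ‖u x‖ = ‖u y + (u x - u y)‖ := by ring_nf
        _ ≤ ‖u y‖ + ‖u x - u y‖ := norm_add_le _ _
        _ ≤ ‖u y‖ + Q * ∫ t in a..x, ‖g t‖ := by
          gcongr; exact h1.trans (mul_le_mul_of_nonneg_left h2 hQ0)
    have hlim : Tendsto (fun y => ‖u y‖ + Q * ∫ t in a..x, ‖g t‖) (𝓝[>] a)
        (𝓝 (0 + Q * ∫ t in a..x, ‖g t‖)) := by
      exact (tendsto_norm_zero.comp hbc).add tendsto_const_nhds
    rw [zero_add] at hlim
    exact ge_of_tendsto hlim (mem_of_superset (Ioo_mem_nhdsGT hx.1) fun y hy => hK y hy)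
  -- Step 2/3: ‖deriv g x‖ ≤ C / √(x − a)
  set C : ℝ := Q * ((1 + N) / 2) / m with hC
  have hC0 : 0 ≤ C := by positivity
  have hderiv_bound : ∀ x ∈ Ioo a b, ‖deriv g x‖ ≤ C * (Real.sqrt (x - a))⁻¹ := by
    intro x hx
    have hxa : 0 < x - a := sub_pos.2 hx.1
    have hsqrt : 0 < Real.sqrt (x - a) := Real.sqrt_pos.2 hxa
    have h1 : ‖u x‖ ≤ Q * ((1 + N) / 2 * Real.sqrt (x - a)) :=
      (hu_bound x hx).trans (mul_le_mul_of_nonneg_left (integral_norm_le_sqrt hgc hL2 hx) hQ0)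
    have h2 : m * (x - a) * ‖deriv g x‖ ≤ ‖u x‖ := by
      rw [hu_def]; dsimp only; rw [norm_mul]
      exact mul_le_mul_of_nonneg_right (hp x hx) (norm_nonneg _)
    have hpos : 0 < m * (x - a) := mul_pos hm hxa
    have h3 : ‖deriv g x‖ ≤ Q * ((1 + N) / 2 * Real.sqrt (x - a)) / (m * (x - a)) := by
      rw [le_div_iff₀ hpos]
      calc ‖deriv g x‖ * (m * (x - a)) = m * (x - a) * ‖deriv g x‖ := by ring
        _ ≤ _ := h2.trans h1
    refine h3.trans (le_of_eq ?_)
    rw [hC]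
    set s : ℝ := Real.sqrt (x - a) with hs_def
    have hs : s * s = x - a := Real.mul_self_sqrt hxa.le
    have hs0 : s ≠ 0 := hsqrt.ne'
    have hm0 : m ≠ 0 := hm.ne'
    rw [← hs]
    field_simp
  -- Step 4: `deriv g` is integrable on `(a, b)`
  have hderiv_int : IntegrableOn (deriv g) (Ioo a b) := by
    have hI : IntervalIntegrable (fun t : ℝ => (t - a) ^ (-(1 / 2 : ℝ))) volume a b := by
      have h := (intervalIntegral.intervalIntegrable_rpow' (a := 0) (b := b - a)
        (by norm_num : (-1 : ℝ) < -(1 / 2))).comp_sub_right a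
      simpa using h
    have hB : IntegrableOn (fun t : ℝ => C * (t - a) ^ (-(1 / 2 : ℝ))) (Ioo a b) :=
      (hI.1.mono_set Ioo_subset_Ioc_self).const_mul C
    refine Integrable.mono' hB (hg'c.aestronglyMeasurable measurableSet_Ioo) ?_
    rw [ae_restrict_iff' measurableSet_Ioo]
    refine ae_of_all _ fun t ht => ?_
    have hta : 0 < t - a := sub_pos.2 ht.1
    have := hderiv_bound t ht
    rwa [Real.sqrt_eq_rpow, ← Real.rpow_neg hta.le] at this
  -- Step 5/6: `g(x) = g(x₁) + ∫_{x₁}^x g′` near `a⁺`, and the primitive of the zero extension is continuous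
  set G : ℝ → ℂ := (Ioo a b).indicator (deriv g) with hG
  have hGint : Integrable G := (integrable_indicator_iff measurableSet_Ioo).2 hderiv_int
  set x₁ : ℝ := (a + b) / 2 with hx₁
  have hx₁m : x₁ ∈ Ioo a b := ⟨left_lt_add_div_two.2 hab, add_div_two_lt_right.2 hab⟩
  have hΦ : Continuous fun x => ∫ t in x₁..x, G t :=
    continuous_primitive (fun _ _ => hGint.intervalIntegrable) x₁
  have hrepr : ∀ x ∈ Ioo a x₁, g x = g x₁ + ∫ t in x₁..x, G t := by
    intro x hx
    have hxb : x < b := hx.2.trans hx₁m.2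
    have hsub : uIcc x x₁ ⊆ Ioo a b := by
      rw [uIcc_of_le hx.2.le]; exact fun t ht => ⟨hx.1.trans_le ht.1, ht.2.trans_lt hx₁m.2⟩
    have hFTC : ∫ t in x..x₁, deriv g t = g x₁ - g x :=
      integral_eq_sub_of_hasDerivAt (fun t ht => hgd t (hsub ht)) ((hg'c.mono hsub).intervalIntegrable)
    have hcongr : ∫ t in x..x₁, G t = ∫ t in x..x₁, deriv g t :=
      intervalIntegral.integral_congr fun t ht => by rw [hG, indicator_of_mem (hsub ht)]
    rw [intervalIntegral.integral_symm, hcongr, hFTC]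
    ring
  refine ⟨g x₁ + ∫ t in x₁..a, G t, ?_⟩
  have hlim : Tendsto (fun x => g x₁ + ∫ t in x₁..x, G t) (𝓝[>] a) (𝓝 (g x₁ + ∫ t in x₁..a, G t)) :=
    ((continuous_const.add hΦ).tendsto a).mono_left nhdsWithin_le_nhds
  refine hlim.congr' ?_
  filter_upwards [Ioo_mem_nhdsGT hx₁m.1] with x hx
  exact (hrepr x hx).symm

/-- Mirror image of `integral_norm_le_sqrt`: `∫_x^b ‖g‖ ≤ (1 + ‖g‖²_{L²(a,b)})/2 · √(b − x)`. [folklore] -/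
private theorem integral_norm_le_sqrt' {a b : ℝ} {g : ℝ → ℂ} (hgc : ContinuousOn g (Ioo a b))
    (hL2 : IntegrableOn (fun x => ‖g x‖ ^ 2) (Ioo a b)) {x : ℝ} (hx : x ∈ Ioo a b) :
    ∫ t in x..b, ‖g t‖ ≤ (1 + ∫ t in Ioo a b, ‖g t‖ ^ 2) / 2 * Real.sqrt (b - x) := by
  have hxb : x < b := hx.2
  have hbx : 0 < b - x := sub_pos.2 hxb
  set N : ℝ := ∫ t in Ioo a b, ‖g t‖ ^ 2 with hN
  have hN0 : 0 ≤ N := setIntegral_nonneg measurableSet_Ioo fun t _ => by positivity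
  set δ : ℝ := (Real.sqrt (b - x))⁻¹ with hδ
  have hsqrt : 0 < Real.sqrt (b - x) := Real.sqrt_pos.2 hbx
  have hδ0 : 0 < δ := inv_pos.2 hsqrt
  have hsub : Ioo x b ⊆ Ioo a b := Ioo_subset_Ioo_left hx.1.le
  have hL2x : IntervalIntegrable (fun t => ‖g t‖ ^ 2) volume x b := by
    rw [intervalIntegrable_iff_integrableOn_Ioo_of_le hxb.le]
    exact hL2.mono_set hsub
  have hgn : IntervalIntegrable (fun t => ‖g t‖) volume x b := by
    rw [intervalIntegrable_iff_integrableOn_Ioo_of_le hxb.le]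
    have hmeas : AEStronglyMeasurable (fun t => ‖g t‖) (volume.restrict (Ioo x b)) :=
      (hgc.mono hsub).norm.aestronglyMeasurable measurableSet_Ioo
    have hc : IntegrableOn (fun _ : ℝ => (1:ℝ)/2) (Ioo x b) volume :=
      integrableOn_const (measure_Ioo_lt_top (a := x) (b := b)).ne
    refine Integrable.mono' (((hL2.mono_set hsub).div_const 1).add hc)
      hmeas (ae_of_all _ fun t => ?_)
    rw [Real.norm_eq_abs, abs_norm]
    simp only [Pi.add_apply, div_one]
    nlinarith [sq_nonneg (‖g t‖ - 1)]
  calc ∫ t in x..b, ‖g t‖ ≤ ∫ t in x..b, (δ + ‖g t‖ ^ 2 / δ) / 2 := by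
        refine intervalIntegral.integral_mono_on hxb.le hgn ?_ fun t _ => le_half_add_sq_div _ hδ0
        exact (intervalIntegrable_const.add (hL2x.div_const δ)).div_const 2
    _ = (δ * (b - x) + (∫ t in x..b, ‖g t‖ ^ 2) / δ) / 2 := by
        rw [intervalIntegral.integral_div, intervalIntegral.integral_add intervalIntegrable_const
          (hL2x.div_const δ), intervalIntegral.integral_const, intervalIntegral.integral_div, smul_eq_mul]
        ring
    _ ≤ (δ * (b - x) + N / δ) / 2 := by
        gcongr
        rw [intervalIntegral.integral_of_le hxb.le, hN]
        calc ∫ t in Ioc x b, ‖g t‖ ^ 2 = ∫ t in Ioo x b, ‖g t‖ ^ 2 := setIntegral_congr_set Ioo_ae_eq_Ioc.symm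
          _ ≤ ∫ t in Ioo a b, ‖g t‖ ^ 2 :=
            setIntegral_mono_set hL2 (ae_of_all _ fun t => by positivity) (ae_of_all _ hsub)
    _ = (1 + N) / 2 * Real.sqrt (b - x) := by
        have h1 : δ * (b - x) = Real.sqrt (b - x) := by
          rw [hδ, inv_mul_eq_div, div_eq_iff hsqrt.ne', Real.mul_self_sqrt hbx.le]
        have h2 : N / δ = N * Real.sqrt (b - x) := by rw [hδ, div_inv_eq_mul]
        rw [h1, h2]; ring

/-- **One-sided limit at a regular singular endpoint (left of `b`)** — the mirror image of
`exists_tendsto_nhdsGT_of_singular_endpoint`: `‖p(x)‖ ≥ m (b − x)` and `p g′ → 0` at `b⁻` give a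
limit of `g` at `b⁻`.
[cite: ConnesMoscovici2022, Cor 1.7 (i) (= arXiv:2112.05500 Cor 2.7, chunk p0006:L116–L123)] -/
theorem exists_tendsto_nhdsLT_of_singular_endpoint {a b m Q : ℝ} (hab : a < b) (hm : 0 < m)
    {g p r : ℝ → ℂ} (hg : ContDiffOn ℝ 1 g (Ioo a b))
    (hu : ∀ x ∈ Ioo a b, HasDerivAt (fun y => p y * deriv g y) (r x * g x) x)
    (hrc : ContinuousOn r (Ioo a b)) (hr : ∀ x ∈ Ioo a b, ‖r x‖ ≤ Q)
    (hp : ∀ x ∈ Ioo a b, m * (b - x) ≤ ‖p x‖)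
    (hbc : Tendsto (fun x => p x * deriv g x) (𝓝[<] b) (𝓝 0))
    (hL2 : IntegrableOn (fun x => ‖g x‖ ^ 2) (Ioo a b)) :
    ∃ c : ℂ, Tendsto g (𝓝[<] b) (𝓝 c) := by
  set u : ℝ → ℂ := fun y => p y * deriv g y with hu_def
  set N : ℝ := ∫ t in Ioo a b, ‖g t‖ ^ 2 with hN
  have hN0 : 0 ≤ N := setIntegral_nonneg measurableSet_Ioo fun t _ => by positivity
  have hQ0 : 0 ≤ Q := (norm_nonneg _).trans (hr _ ⟨(left_lt_add_div_two.2 hab), add_div_two_lt_right.2 hab⟩)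
  have hgc : ContinuousOn g (Ioo a b) := hg.continuousOn
  have hgd : ∀ x ∈ Ioo a b, HasDerivAt g (deriv g x) x := fun x hx =>
    ((hg.differentiableOn one_ne_zero x hx).differentiableAt (Ioo_mem_nhds hx.1 hx.2)).hasDerivAt
  have hg'c : ContinuousOn (deriv g) (Ioo a b) := hg.continuousOn_deriv_of_isOpen isOpen_Ioo le_rfl
  -- Step 1: ‖u x‖ ≤ Q ∫_x^b ‖g‖
  have hgn_int : ∀ x ∈ Ioo a b, IntervalIntegrable (fun t => ‖g t‖) volume x b := by
    intro x hx
    rw [intervalIntegrable_iff_integrableOn_Ioo_of_le hx.2.le]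
    have hsub : Ioo x b ⊆ Ioo a b := Ioo_subset_Ioo_left hx.1.le
    have hmeas : AEStronglyMeasurable (fun t => ‖g t‖) (volume.restrict (Ioo x b)) :=
      (hgc.mono hsub).norm.aestronglyMeasurable measurableSet_Ioo
    have hc : IntegrableOn (fun _ : ℝ => (1:ℝ)/2) (Ioo x b) volume :=
      integrableOn_const (measure_Ioo_lt_top (a := x) (b := b)).ne
    refine Integrable.mono' (((hL2.mono_set hsub).div_const 1).add hc)
      hmeas (ae_of_all _ fun t => ?_)
    rw [Real.norm_eq_abs, abs_norm]
    simp only [Pi.add_apply, div_one]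
    nlinarith [sq_nonneg (‖g t‖ - 1)]
  have hu_bound : ∀ x ∈ Ioo a b, ‖u x‖ ≤ Q * ∫ t in x..b, ‖g t‖ := by
    intro x hx
    have hK : ∀ y ∈ Ioo x b, ‖u x‖ ≤ ‖u y‖ + Q * ∫ t in x..b, ‖g t‖ := by
      intro y hy
      have hay : a < y := hx.1.trans hy.1
      have hsub : uIcc x y ⊆ Ioo a b := by
        rw [uIcc_of_le hy.1.le]; exact fun t ht => ⟨hx.1.trans_le ht.1, ht.2.trans_lt hy.2⟩
      have hFTC : ∫ t in x..y, r t * g t = u y - u x :=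
        integral_eq_sub_of_hasDerivAt (fun t ht => hu t (hsub ht))
          (((hrc.mul hgc).mono hsub).intervalIntegrable)
      have h1 : ‖u y - u x‖ ≤ Q * ∫ t in x..y, ‖g t‖ := by
        rw [← hFTC]
        calc ‖∫ t in x..y, r t * g t‖ ≤ ∫ t in x..y, Q * ‖g t‖ := by
              refine intervalIntegral.norm_integral_le_of_norm_le hy.1.le
                (ae_of_all _ fun t ht => ?_) (((hgn_int x hx).mono_set ?_).const_mul Q)
              · rw [norm_mul]
                exact mul_le_mul_of_nonneg_right (hr t ⟨hx.1.trans ht.1, ht.2.trans_lt hy.2⟩)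
                  (norm_nonneg _)
              · rw [uIcc_of_le hy.1.le, uIcc_of_le hx.2.le]; exact Icc_subset_Icc le_rfl hy.2.le
          _ = Q * ∫ t in x..y, ‖g t‖ := intervalIntegral.integral_const_mul _ _
      have h2 : ∫ t in x..y, ‖g t‖ ≤ ∫ t in x..b, ‖g t‖ := by
        have hi1 : IntervalIntegrable (fun t => ‖g t‖) volume x y :=
          (hgn_int x hx).mono_set (by
            rw [uIcc_of_le hy.1.le, uIcc_of_le hx.2.le]; exact Icc_subset_Icc le_rfl hy.2.le)
        have hi2 : IntervalIntegrable (fun t => ‖g t‖) volume y b :=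
          (hgn_int x hx).mono_set (by
            rw [uIcc_of_le hy.2.le, uIcc_of_le hx.2.le]; exact Icc_subset_Icc hy.1.le le_rfl)
        have hadd := intervalIntegral.integral_add_adjacent_intervals hi1 hi2
        have h0 : 0 ≤ ∫ t in y..b, ‖g t‖ :=
          intervalIntegral.integral_nonneg hy.2.le fun t _ => norm_nonneg _
        linarith
      calc ‖u x‖ = ‖u y - (u y - u x)‖ := by ring_nf
        _ ≤ ‖u y‖ + ‖u y - u x‖ := norm_sub_le _ _
        _ ≤ ‖u y‖ + Q * ∫ t in x..b, ‖g t‖ := by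
          gcongr; exact h1.trans (mul_le_mul_of_nonneg_left h2 hQ0)
    have hlim : Tendsto (fun y => ‖u y‖ + Q * ∫ t in x..b, ‖g t‖) (𝓝[<] b)
        (𝓝 (0 + Q * ∫ t in x..b, ‖g t‖)) := by
      exact (tendsto_norm_zero.comp hbc).add tendsto_const_nhds
    rw [zero_add] at hlim
    exact ge_of_tendsto hlim (mem_of_superset (Ioo_mem_nhdsLT hx.2) fun y hy => hK y hy)
  -- Step 2/3: ‖deriv g x‖ ≤ C / √(b − x)
  set C : ℝ := Q * ((1 + N) / 2) / m with hC
  have hC0 : 0 ≤ C := by positivity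
  have hderiv_bound : ∀ x ∈ Ioo a b, ‖deriv g x‖ ≤ C * (Real.sqrt (b - x))⁻¹ := by
    intro x hx
    have hbx : 0 < b - x := sub_pos.2 hx.2
    have hsqrt : 0 < Real.sqrt (b - x) := Real.sqrt_pos.2 hbx
    have h1 : ‖u x‖ ≤ Q * ((1 + N) / 2 * Real.sqrt (b - x)) :=
      (hu_bound x hx).trans (mul_le_mul_of_nonneg_left (integral_norm_le_sqrt' hgc hL2 hx) hQ0)
    have h2 : m * (b - x) * ‖deriv g x‖ ≤ ‖u x‖ := by
      rw [hu_def]; dsimp only; rw [norm_mul]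
      exact mul_le_mul_of_nonneg_right (hp x hx) (norm_nonneg _)
    have hpos : 0 < m * (b - x) := mul_pos hm hbx
    have h3 : ‖deriv g x‖ ≤ Q * ((1 + N) / 2 * Real.sqrt (b - x)) / (m * (b - x)) := by
      rw [le_div_iff₀ hpos]
      calc ‖deriv g x‖ * (m * (b - x)) = m * (b - x) * ‖deriv g x‖ := by ring
        _ ≤ _ := h2.trans h1
    refine h3.trans (le_of_eq ?_)
    rw [hC]
    set s : ℝ := Real.sqrt (b - x) with hs_def
    have hs : s * s = b - x := Real.mul_self_sqrt hbx.le
    have hs0 : s ≠ 0 := hsqrt.ne'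
    have hm0 : m ≠ 0 := hm.ne'
    rw [← hs]
    field_simp
  -- Step 4: `deriv g` is integrable on `(a, b)`
  have hderiv_int : IntegrableOn (deriv g) (Ioo a b) := by
    have hI : IntervalIntegrable (fun t : ℝ => (b - t) ^ (-(1 / 2 : ℝ))) volume a b := by
      have h := (intervalIntegral.intervalIntegrable_rpow' (a := 0) (b := b - a)
        (by norm_num : (-1 : ℝ) < -(1 / 2))).comp_sub_left b
      simp only [sub_zero, sub_sub_cancel] at h
      exact h.symm
    have hB : IntegrableOn (fun t : ℝ => C * (b - t) ^ (-(1 / 2 : ℝ))) (Ioo a b) :=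
      (hI.1.mono_set Ioo_subset_Ioc_self).const_mul C
    refine Integrable.mono' hB (hg'c.aestronglyMeasurable measurableSet_Ioo) ?_
    rw [ae_restrict_iff' measurableSet_Ioo]
    refine ae_of_all _ fun t ht => ?_
    have htb : 0 < b - t := sub_pos.2 ht.2
    have := hderiv_bound t ht
    rwa [Real.sqrt_eq_rpow, ← Real.rpow_neg htb.le] at this
  -- Step 5/6
  set G : ℝ → ℂ := (Ioo a b).indicator (deriv g) with hG
  have hGint : Integrable G := (integrable_indicator_iff measurableSet_Ioo).2 hderiv_int
  set x₁ : ℝ := (a + b) / 2 with hx₁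
  have hx₁m : x₁ ∈ Ioo a b := ⟨left_lt_add_div_two.2 hab, add_div_two_lt_right.2 hab⟩
  have hΦ : Continuous fun x => ∫ t in x₁..x, G t :=
    continuous_primitive (fun _ _ => hGint.intervalIntegrable) x₁
  have hrepr : ∀ x ∈ Ioo x₁ b, g x = g x₁ + ∫ t in x₁..x, G t := by
    intro x hx
    have hsub : uIcc x₁ x ⊆ Ioo a b := by
      rw [uIcc_of_le hx.1.le]; exact fun t ht => ⟨hx₁m.1.trans_le ht.1, ht.2.trans_lt hx.2⟩
    have hFTC : ∫ t in x₁..x, deriv g t = g x - g x₁ :=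
      integral_eq_sub_of_hasDerivAt (fun t ht => hgd t (hsub ht)) ((hg'c.mono hsub).intervalIntegrable)
    have hcongr : ∫ t in x₁..x, G t = ∫ t in x₁..x, deriv g t :=
      intervalIntegral.integral_congr fun t ht => by rw [hG, indicator_of_mem (hsub ht)]
    rw [hcongr, hFTC]
    ring
  refine ⟨g x₁ + ∫ t in x₁..b, G t, ?_⟩
  have hlim : Tendsto (fun x => g x₁ + ∫ t in x₁..x, G t) (𝓝[<] b) (𝓝 (g x₁ + ∫ t in x₁..b, G t)) :=
    ((continuous_const.add hΦ).tendsto b).mono_left nhdsWithin_le_nhds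
  refine hlim.congr' ?_
  filter_upwards [Ioo_mem_nhdsLT hx₁m.2] with x hx
  exact (hrepr x hx).symm


end Endpoint

/-! ## Application: eigenfunctions of `W_sa` near the singular point `λ`
([ConnesMoscovici2022, Cor 1.7 (i)]) -/

section Prolate

open Literature.NumberTheory.ConnesConsani2024

variable {lam : ℝ}

/-- `S = ℝ ∖ {±λ}` is open (plumbing). [folklore] -/
private theorem isOpen_ne_ne' (lam : ℝ) : IsOpen {x : ℝ | x ≠ lam ∧ x ≠ -lam} :=
  isOpen_ne.and isOpen_ne

/-- For the boundary-condition representative `g` of `ξ ∈ dom W_max` with `W_max ξ = μ ξ`: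
`u = p g′` is differentiable off `±λ` with `u′ = (q − μ) g` (the classical equation
`−(p g′)′ + q g = μ g`, [ConnesMoscovici2022, §1 (1.1)–(1.2)], via seat cc-t9's interior regularity).
[cite: ConnesMoscovici2022, §1 eq. (1.1)–(1.2) (= arXiv:2112.05500 §2 (2.1)–(2.2), chunk p0004:L13–L22)] -/
theorem hasDerivAt_pCoeff_mul_deriv_repr (hlam : 0 < lam) {φ : L2R}
    (hφ : φ ∈ (prolateMax lam).domain) {μ : ℝ} (hW : prolateMax lam ⟨φ, hφ⟩ = (μ : ℂ) • φ)
    {g : ℝ → ℂ} (hfg : (φ : ℝ → ℂ) =ᵐ[volume] g)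
    (hgd : DifferentiableOn ℝ g {x | x ≠ lam ∧ x ≠ -lam}) {x : ℝ} (h₁ : x ≠ lam) (h₂ : x ≠ -lam) :
    HasDerivAt (fun y => pCoeff lam y * deriv g y) ((qCoeff lam x - μ) * g x) x := by
  have hS := isOpen_ne_ne' lam
  have hxS : x ∈ {x : ℝ | x ≠ lam ∧ x ≠ -lam} := ⟨h₁, h₂⟩
  have hsm := contDiffOn_repr_of_mem_prolateMax lam hlam hφ hW hfg hgd
  have hd1 : ContDiffOn ℝ 1 (deriv g) {x : ℝ | x ≠ lam ∧ x ≠ -lam} :=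
    hsm.deriv_of_isOpen hS (by norm_cast)
  have hdg : DifferentiableAt ℝ (deriv g) x :=
    (hd1.differentiableOn one_ne_zero x hxS).differentiableAt (hS.mem_nhds hxS)
  have hp : DifferentiableAt ℝ (fun y => pCoeff lam y) x := by
    unfold pCoeff
    exact (((differentiableAt_const _).sub (differentiableAt_pow 2)).hasDerivAt.ofReal_comp).differentiableAt
  have hprod : DifferentiableAt ℝ (fun y => pCoeff lam y * deriv g y) x := hp.mul hdg
  have heq := prolateWaveOpFun_repr_eq lam hlam hφ hW hfg hgd h₁ h₂
  -- `prolateWaveOpFun lam g x = -deriv (p g′) x + (2πλx)² g x`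
  have hderiv : deriv (fun y => pCoeff lam y * deriv g y) x = (qCoeff lam x - μ) * g x := by
    have h' : -deriv (fun y => pCoeff lam y * deriv g y) x + ((2 * π * lam * x : ℝ) : ℂ) ^ 2 * g x =
        μ * g x := heq
    have hq : qCoeff lam x = ((2 * π * lam * x : ℝ) : ℂ) ^ 2 := by
      unfold qCoeff; push_cast; ring
    rw [hq]
    linear_combination (-1 : ℂ) * h'
  exact hderiv ▸ hprod.hasDerivAt

/-- Square integrability of the representative on any measurable set (plumbing: `ξ ∈ L²`).
[folklore] -/
private theorem integrableOn_norm_sq_repr {φ : L2R} {g : ℝ → ℂ} (hfg : (φ : ℝ → ℂ) =ᵐ[volume] g)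
    (s : Set ℝ) : IntegrableOn (fun x => ‖g x‖ ^ 2) s := by
  have h1 : Integrable (fun x => ‖(φ : ℝ → ℂ) x‖ ^ (2 : ℝ)) :=
    by simpa using (Lp.memLp φ).integrable_norm_rpow two_ne_zero ENNReal.ofNat_ne_top
  have h2 : Integrable (fun x => ‖g x‖ ^ 2) := by
    refine (h1.congr ?_)
    filter_upwards [hfg] with x hx
    rw [hx, Real.rpow_two]
  exact h2.integrableOn

/-- **Connes–Moscovici 2022, Corollary 1.7 (i)** (= arXiv Cor 2.7 (i)), for the eigenfunction's
boundary-condition representative `g`: `g` is smooth on `(λ, 2λ)` and on `(0, λ)` and HAS ONE-SIDED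
LIMITS at `λ` ("`φ` is regular on `[λ, λ+ε)` and on `(λ−ε, λ]` … with a possible discontinuity at `λ`";
the typed fact `CM22_cor_1_7` asks exactly this for clause (i)).  The representative also satisfies
the boundary conditions and is smooth off `±λ`, recorded for the asymptotic clause (ii) (not proved
here).  Proof: interior regularity (`contDiffOn_repr_of_mem_prolateMax`, seat cc-t9) + the abstract
endpoint lemmas with `p = λ² − x²` (`|p| ≥ 2λ(x−λ)`, resp. `≥ λ(λ−x)`) and the boundary condition
(1.19) `p g′ → 0` at `λ`.
[cite: ConnesMoscovici2022, Cor 1.7 (i) (= arXiv:2112.05500 Cor 2.7, chunk p0006:L116–L123; proof p0007:L1–L4)] -/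
theorem CM22_cor_1_7_i (lam : ℝ) (hlam : 0 < lam) (W : L2R →ₗ.[ℂ] L2R) (hSA : IsProlateSA lam W)
    (μ : ℝ) (φ : L2R) (hev : W.HasEigenvector (μ : ℂ) φ) :
    ∃ g : ℝ → ℂ, (φ : ℝ → ℂ) =ᵐ[volume] g ∧
      (∃ ε > 0, ContDiffOn ℝ (⊤ : ℕ∞) g (Ioo lam (lam + ε)) ∧
        ContDiffOn ℝ (⊤ : ℕ∞) g (Ioo (lam - ε) lam) ∧
        (∃ c, Tendsto g (𝓝[>] lam) (𝓝 c)) ∧ ∃ c, Tendsto g (𝓝[<] lam) (𝓝 c)) ∧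
      ProlateBC lam g ∧ ContDiffOn ℝ (⊤ : ℕ∞) g {x | x ≠ lam ∧ x ≠ -lam} := by
  obtain ⟨hφ, hW, g, hfg, hbc⟩ := exists_repr_of_hasEigenvector hSA hev
  have hgd := hbc.differentiableOn
  have hsm := contDiffOn_repr_of_mem_prolateMax lam hlam hφ hW hfg hgd
  have hright_sub : Ioo lam (lam + lam) ⊆ {x : ℝ | x ≠ lam ∧ x ≠ -lam} := fun x hx =>
    ⟨ne_of_gt hx.1, by intro h; rw [h] at hx; linarith [hx.1]⟩
  have hleft_sub : Ioo (lam - lam) lam ⊆ {x : ℝ | x ≠ lam ∧ x ≠ -lam} := fun x hx =>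
    ⟨ne_of_lt hx.2, by intro h; rw [h, sub_self] at hx; linarith [hx.1]⟩
  -- data for the endpoint lemmas
  have hu : ∀ x ∈ {x : ℝ | x ≠ lam ∧ x ≠ -lam},
      HasDerivAt (fun y => pCoeff lam y * deriv g y) ((qCoeff lam x - μ) * g x) x :=
    fun x hx => hasDerivAt_pCoeff_mul_deriv_repr hlam hφ hW hfg hgd hx.1 hx.2
  have hrc : Continuous fun x => qCoeff lam x - (μ : ℂ) := by unfold qCoeff; fun_prop
  set Q : ℝ := (2 * π * lam) ^ 2 * (lam + lam) ^ 2 + |μ| with hQ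
  have hr : ∀ x ∈ Ioo (lam - lam) (lam + lam), ‖qCoeff lam x - (μ : ℂ)‖ ≤ Q := by
    intro x hx
    rw [sub_self] at hx
    have hx2 : x ^ 2 ≤ (lam + lam) ^ 2 :=
      sq_le_sq' (by linarith [hx.1]) hx.2.le
    calc ‖qCoeff lam x - (μ : ℂ)‖ ≤ ‖qCoeff lam x‖ + ‖(μ : ℂ)‖ := norm_sub_le _ _
      _ = (2 * π * lam) ^ 2 * x ^ 2 + |μ| := by
          rw [qCoeff, Complex.norm_real, Complex.norm_real, Real.norm_eq_abs, Real.norm_eq_abs,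
            abs_of_nonneg (by positivity)]
      _ ≤ Q := by rw [hQ]; gcongr
  have hL2 := integrableOn_norm_sq_repr hfg
  -- right of λ: interval (λ, 2λ), ‖p‖ ≥ 2λ (x − λ)
  have hright : ∃ c, Tendsto g (𝓝[>] lam) (𝓝 c) := by
    have hab : lam < lam + lam := by linarith
    refine exists_tendsto_nhdsGT_of_singular_endpoint hab (by positivity : (0:ℝ) < 2 * lam)
      ((hsm.mono hright_sub).of_le (by exact_mod_cast le_top))
      (fun x hx => hu x (hright_sub hx)) hrc.continuousOn
      (fun x hx => hr x ⟨by rw [sub_self]; linarith [hx.1], hx.2⟩) (fun x hx => ?_) ?_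
      (hL2 _)
    · rw [pCoeff, Complex.norm_real, Real.norm_eq_abs, abs_of_nonpos (by nlinarith [hx.1, hx.2])]
      nlinarith [hx.1, hx.2]
    · refine hbc.atLam.mono_left (nhdsWithin_mono _ fun x hx => ?_)
      exact ⟨ne_of_gt hx, by intro h; rw [h] at hx; exact absurd hx (by simp; linarith)⟩
  -- left of λ: interval (0, λ), ‖p‖ ≥ λ (λ − x)
  have hleft : ∃ c, Tendsto g (𝓝[<] lam) (𝓝 c) := by
    have hab : lam - lam < lam := by linarith
    refine exists_tendsto_nhdsLT_of_singular_endpoint hab hlam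
      ((hsm.mono hleft_sub).of_le (by exact_mod_cast le_top))
      (fun x hx => hu x (hleft_sub hx)) hrc.continuousOn
      (fun x hx => hr x ⟨hx.1, by linarith [hx.2]⟩) (fun x hx => ?_) ?_ (hL2 _)
    · rw [sub_self] at hx
      rw [pCoeff, Complex.norm_real, Real.norm_eq_abs, abs_of_nonneg (by nlinarith [hx.1, hx.2])]
      nlinarith [hx.1, hx.2]
    · rw [← nhdsWithin_Ioo_eq_nhdsLT hab]
      exact hbc.atLam.mono_left (nhdsWithin_mono _ hleft_sub)
  exact ⟨g, hfg, ⟨lam, hlam, (hsm.mono hright_sub), (hsm.mono hleft_sub), hright, hleft⟩, hbc, hsm⟩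

/-- Clause (i) of the named fact `CM22_cor_1_7` in its exact binder shape (the asymptotic clause (ii)
is not addressed here). [cite: ConnesMoscovici2022, Cor 1.7 (i) (= arXiv:2112.05500 Cor 2.7, chunk p0006:L116–L123)] -/
theorem CM22_cor_1_7_clause_i :
    ∀ lam : ℝ, 0 < lam → ∀ W : L2R →ₗ.[ℂ] L2R, IsProlateSA lam W →
      ∀ (μ : ℝ) (φ : L2R), W.HasEigenvector (μ : ℂ) φ →
        ∃ g : ℝ → ℂ, (φ : ℝ → ℂ) =ᵐ[volume] g ∧
          (∃ ε > 0, ContDiffOn ℝ (⊤ : ℕ∞) g (Ioo lam (lam + ε)) ∧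
            ContDiffOn ℝ (⊤ : ℕ∞) g (Ioo (lam - ε) lam) ∧
            (∃ c, Tendsto g (𝓝[>] lam) (𝓝 c)) ∧ ∃ c, Tendsto g (𝓝[<] lam) (𝓝 c)) := by
  intro lam hlam W hSA μ φ hev
  obtain ⟨g, hfg, h, -, -⟩ := CM22_cor_1_7_i lam hlam W hSA μ φ hev
  exact ⟨g, hfg, h⟩

end Prolate

section NegLam

open Literature.NumberTheory.ConnesConsani2024

variable {lam : ℝ}

/-- **One-sided limits at BOTH singular points `±λ`** for the boundary-condition representative of an
eigenvector of `W_sa` (the same representative as in `CM22_cor_1_7_i`; at `−λ` the endpoint lemmas are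
applied on `(−λ, 0)` with `|p| ≥ λ (x + λ)` and on `(−2λ, −λ)` with `|p| ≥ 2λ (−λ − x)`, using the
boundary condition (1.19) at `−λ`).  Exported for Green's-formula arguments on all three components
of `ℝ ∖ {±λ}` without parity assumptions.
[cite: ConnesMoscovici2022, Cor 1.7 (i) and (1.19) (= arXiv:2112.05500 Cor 2.7, (2.19), chunk p0006:L55–L58, L116–L123)] -/
theorem CM22_cor_1_7_i_both (lam : ℝ) (hlam : 0 < lam) (W : L2R →ₗ.[ℂ] L2R) (hSA : IsProlateSA lam W)
    (μ : ℝ) (φ : L2R) (hev : W.HasEigenvector (μ : ℂ) φ) :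
    ∃ g : ℝ → ℂ, (φ : ℝ → ℂ) =ᵐ[volume] g ∧ ProlateBC lam g ∧
      ContDiffOn ℝ (⊤ : ℕ∞) g {x | x ≠ lam ∧ x ≠ -lam} ∧
      (∃ c, Tendsto g (𝓝[>] lam) (𝓝 c)) ∧ (∃ c, Tendsto g (𝓝[<] lam) (𝓝 c)) ∧
      (∃ c, Tendsto g (𝓝[>] (-lam)) (𝓝 c)) ∧ (∃ c, Tendsto g (𝓝[<] (-lam)) (𝓝 c)) := by
  obtain ⟨g, hfg, ⟨ε, -, -, -, hR, hL⟩, hbc, hsm⟩ := CM22_cor_1_7_i lam hlam W hSA μ φ hev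
  obtain ⟨hφ, hW, -⟩ := exists_repr_of_hasEigenvector hSA hev
  have hgd := hbc.differentiableOn
  have hu : ∀ x ∈ {x : ℝ | x ≠ lam ∧ x ≠ -lam},
      HasDerivAt (fun y => pCoeff lam y * deriv g y) ((qCoeff lam x - μ) * g x) x :=
    fun x hx => hasDerivAt_pCoeff_mul_deriv_repr hlam hφ hW hfg hgd hx.1 hx.2
  have hrc : Continuous fun x => qCoeff lam x - (μ : ℂ) := by unfold qCoeff; fun_prop
  set Q : ℝ := (2 * π * lam) ^ 2 * (lam + lam) ^ 2 + |μ| with hQ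
  have hr : ∀ x ∈ Ioo (-lam - lam) (-lam + lam), ‖qCoeff lam x - (μ : ℂ)‖ ≤ Q := by
    intro x hx
    have hx2 : x ^ 2 ≤ (lam + lam) ^ 2 := by
      rw [← sq_abs x]
      exact sq_le_sq' (by linarith [abs_nonneg x]) (abs_le.2 ⟨by linarith [hx.1], by linarith [hx.2]⟩)
    calc ‖qCoeff lam x - (μ : ℂ)‖ ≤ ‖qCoeff lam x‖ + ‖(μ : ℂ)‖ := norm_sub_le _ _
      _ = (2 * π * lam) ^ 2 * x ^ 2 + |μ| := by
          rw [qCoeff, Complex.norm_real, Complex.norm_real, Real.norm_eq_abs, Real.norm_eq_abs,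
            abs_of_nonneg (by positivity)]
      _ ≤ Q := by rw [hQ]; gcongr
  have hL2 := integrableOn_norm_sq_repr hfg
  have hright_sub : Ioo (-lam) (-lam + lam) ⊆ {x : ℝ | x ≠ lam ∧ x ≠ -lam} := fun x hx =>
    ⟨by intro h; rw [h] at hx; linarith [hx.2], ne_of_gt hx.1⟩
  have hleft_sub : Ioo (-lam - lam) (-lam) ⊆ {x : ℝ | x ≠ lam ∧ x ≠ -lam} := fun x hx =>
    ⟨by intro h; rw [h] at hx; linarith [hx.2], ne_of_lt hx.2⟩
  -- right of −λ: interval (−λ, 0), ‖p‖ ≥ λ (x + λ)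
  have hright : ∃ c, Tendsto g (𝓝[>] (-lam)) (𝓝 c) := by
    have hab : -lam < -lam + lam := by linarith
    refine exists_tendsto_nhdsGT_of_singular_endpoint hab hlam
      ((hsm.mono hright_sub).of_le (by exact_mod_cast le_top))
      (fun x hx => hu x (hright_sub hx)) hrc.continuousOn
      (fun x hx => hr x ⟨by linarith [hx.1], hx.2⟩) (fun x hx => ?_) ?_ (hL2 _)
    · rw [pCoeff, Complex.norm_real, Real.norm_eq_abs, abs_of_nonneg (by nlinarith [hx.1, hx.2])]
      nlinarith [hx.1, hx.2]
    · rw [← nhdsWithin_Ioo_eq_nhdsGT hab]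
      exact hbc.atNegLam.mono_left (nhdsWithin_mono _ hright_sub)
  -- left of −λ: interval (−2λ, −λ), ‖p‖ ≥ 2λ (−λ − x)
  have hleft : ∃ c, Tendsto g (𝓝[<] (-lam)) (𝓝 c) := by
    have hab : -lam - lam < -lam := by linarith
    refine exists_tendsto_nhdsLT_of_singular_endpoint hab (by positivity : (0:ℝ) < 2 * lam)
      ((hsm.mono hleft_sub).of_le (by exact_mod_cast le_top))
      (fun x hx => hu x (hleft_sub hx)) hrc.continuousOn
      (fun x hx => hr x ⟨hx.1, by linarith [hx.2]⟩) (fun x hx => ?_) ?_ (hL2 _)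
    · rw [pCoeff, Complex.norm_real, Real.norm_eq_abs, abs_of_nonpos (by nlinarith [hx.1, hx.2])]
      nlinarith [hx.1, hx.2]
    · refine hbc.atNegLam.mono_left (nhdsWithin_mono _ fun x hx => ?_)
      exact ⟨by intro h; rw [h] at hx; exact absurd hx (by simp; linarith), ne_of_lt hx⟩
  exact ⟨g, hfg, hbc, hsm, hR, hL, hright, hleft⟩

end NegLam

end Literature.NumberTheory.ConnesMoscovici2022
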